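import Mathlib
import Summits.KontsevichZagierPeriods.KontsevichZagierPeriods.Theorems.HyperbolicBlochOffTetraSectorKernelRungZeroLogRelations

/-!
# Crux `TorsionLogs.NeronTorsionSector` (stmt-KontsevichZagierPeriods-14500) — assembly, final packaging

Helper for the lead's stub `stub_assembly` (line `registered`): once the translation chain has realised
`q²•[rI] + p²•[rP]` as a `ℤ`-combination of INTERVAL LOG CARRIERS `[(αᵢ, βᵢ), dt/t]` (`0 < αᵢ ≤ βᵢ` real
algebraic) modulo `KZ.relations`, the primitive chain in the registered shape
`∃ c B rB, 1 < B ∧ IsAlgebraic ℚ B ∧ rB = [1 < t < B, dt/t] ∧ q²•[rI] + p²•[rP] − c•[rB] ∈ relations` follows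
from the landed rank-one log calculus `interval_log_relation_mem_relations` (every `ℤ`-relation among the
logarithms of real algebraic numbers is a chain of moves): with `V = Σ εᵢ log(βᵢ/αᵢ)`, take `B = e^{|V|}`
(`= ∏ (βᵢ/αᵢ)^{±εᵢ}`, algebraic), `c = sign V`, or `c = 0`, `B = 2` if `V = 0`.
[cite: KontsevichZagier2001, §1.2]
-/

noncomputable section

open Set MeasureTheory
open Literature.NumberTheory.Transcendental Literature.NumberTheory.Transcendental.KZ
open Summit.KontsevichZagierPeriods.HyperbolicBloch.OffTetraSectorKernel (exists_logRep
  interval_log_relation_mem_relations)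

-- `Summit.KontsevichZagierPeriods.KontsevichZagierPeriods.…` is the tree's mandated layout (single-conjunct summit).
set_option linter.dupNamespace false

namespace Summit.KontsevichZagierPeriods.KontsevichZagierPeriods.Cruxes.NeronTorsionSector.Translation

/-- `exp (Σ εᵢ log rᵢ) = ∏ rᵢ ^ εᵢ` for `rᵢ > 0`, and it is algebraic when the `rᵢ` are. [folklore] -/
theorem isAlgebraic_exp_sum_mul_log {κ : ℕ} (r : Fin κ → ℝ) (ε : Fin κ → ℤ)
    (hr : ∀ i, 0 < r i) (halg : ∀ i, IsAlgebraic ℚ (r i)) :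
    IsAlgebraic ℚ (Real.exp (∑ i, (ε i : ℝ) * Real.log (r i))) := by
  rw [Real.exp_sum]
  have hfac : ∀ i, Real.exp ((ε i : ℝ) * Real.log (r i)) = r i ^ (ε i) := by
    intro i
    rw [mul_comm, ← Real.rpow_def_of_pos (hr i), Real.rpow_intCast]
  simp_rw [hfac]
  -- integer powers of algebraic reals are algebraic (cf. the tree's `…PiBox.Dlog.isAlgebraic_zpow`,
  -- not imported to keep this file's import cone small)
  have hz : ∀ i, IsAlgebraic ℚ (r i ^ ε i) := by
    intro i
    rcases Int.eq_nat_or_neg (ε i) with ⟨k, hk | hk⟩ <;> rw [hk]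
    · rw [zpow_natCast]
      exact (halg i).pow k
    · rw [zpow_neg, zpow_natCast]
      exact IsAlgebraic.inv_iff.mpr ((halg i).pow k)
  exact Finset.prod_induction _ (IsAlgebraic ℚ) (fun a b ha hb => ha.mul hb) isAlgebraic_one
    (fun i _ => hz i)

/-- **Final packaging of the primitive chain.** If a formal combination `X` is, modulo `KZ.relations`, a
`ℤ`-combination of interval log carriers `[(αᵢ, βᵢ), dt/t]` with `0 < αᵢ ≤ βᵢ` real algebraic, then there
are `c ∈ ℤ`, a real algebraic `B > 1` and a log carrier `rB = [1 < t < B, dt/t]` with `X − c•[rB] ∈ relations`: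
put `V := Σ εᵢ log(βᵢ/αᵢ)`; if `V = 0` the carriers are themselves a chain of moves
(`interval_log_relation_mem_relations`) and `c = 0`, `B = 2`; otherwise `B := e^{|V|} = ∏(βᵢ/αᵢ)^{±εᵢ}` is
algebraic and the enlarged family with `∓[rB]` has vanishing log-sum. [cite: KontsevichZagier2001, §1.2] -/
theorem exists_carrier_of_logFamily : ∀ (X : Literature.NumberTheory.Transcendental.KZ.FormalRep) {κ : ℕ} (α β : Fin κ → ℝ) (ε : Fin κ → ℤ) (cs : Fin κ → Literature.NumberTheory.Transcendental.KZ.IntegralRep 1), (∀ i, 0 < α i) → (∀ i, α i ≤ β i) → (∀ i, IsAlgebraic ℚ (α i)) → (∀ i, IsAlgebraic ℚ (β i)) → (∀ i, (cs i).domain = {t | α i < t 0 ∧ t 0 < β i}) → (∀ i, Set.EqOn (cs i).integrand (fun t => 1 / t 0) (cs i).domain) → X - ∑ i, ε i • Literature.NumberTheory.Transcendental.KZ.of (cs i) ∈ Literature.NumberTheory.Transcendental.KZ.relations → ∃ (c : ℤ) (B : ℝ) (rB : Literature.NumberTheory.Transcendental.KZ.IntegralRep 1), 1 < B ∧ IsAlgebraic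 ℚ B ∧ rB.domain = {t | 1 < t 0 ∧ t 0 < B} ∧ Set.EqOn rB.integrand (fun t => (t 0)⁻¹) rB.domain ∧ X - c • Literature.NumberTheory.Transcendental.KZ.of rB ∈ Literature.NumberTheory.Transcendental.KZ.relations := by
  intro X κ α β ε cs hα hαβ hαa hβa hdom hint hX
  set V : ℝ := ∑ i, (ε i : ℝ) * Real.log (β i / α i) with hV
  -- the enlarged family: the given carriers plus one carrier `[1 < t < B]` with coefficient `-c`
  have key : ∀ (c : ℤ) (B : ℝ) (rB : IntegralRep 1), 1 ≤ B → IsAlgebraic ℚ B →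
      rB.domain = {t | 1 < t 0 ∧ t 0 < B} → Set.EqOn rB.integrand (fun t => (t 0)⁻¹) rB.domain →
      V - c * Real.log B = 0 → X - c • of rB ∈ relations := by
    intro c B rB hB hBa hdB hiB hsum
    have h := interval_log_relation_mem_relations (κ + 1) (Fin.snoc α 1) (Fin.snoc β B)
      (Fin.snoc ε (-c)) (Fin.snoc cs rB)
      (fun i => by
        refine Fin.lastCases ?_ (fun j => ?_) i
        · simp
        · simpa using hα j)
      (fun i => by
        refine Fin.lastCases ?_ (fun j => ?_) i
        · simpa using hB
        · simpa using hαβ j)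
      (fun i => by
        refine Fin.lastCases ?_ (fun j => ?_) i
        · simpa using isAlgebraic_one
        · simpa using hαa j)
      (fun i => by
        refine Fin.lastCases ?_ (fun j => ?_) i
        · simpa using hBa
        · simpa using hβa j)
      (fun i => by
        refine Fin.lastCases ?_ (fun j => ?_) i
        · refine ⟨by simpa using hdB, ?_⟩
          simp only [Fin.snoc_last]
          intro t ht
          simp [hiB ht]
        · refine ⟨by simpa using hdom j, ?_⟩
          simp only [Fin.snoc_castSucc]
          exact hint j)
      (by
        rw [Fin.sum_univ_castSucc]
        simp only [Fin.snoc_castSucc, Fin.snoc_last, div_one, Int.cast_neg]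
        rw [← hV]
        linear_combination hsum)
    rw [Fin.sum_univ_castSucc] at h
    simp only [Fin.snoc_castSucc, Fin.snoc_last, neg_smul] at h
    -- `h : ∑ εᵢ•[csᵢ] - c•[rB] ∈ relations`
    have e : X - c • of rB = (X - ∑ i, ε i • of (cs i)) + (∑ i, ε i • of (cs i) + -(c • of rB)) := by
      abel
    rw [e]
    exact relations.add_mem hX h
  rcases lt_trichotomy V 0 with hneg | hzero | hpos
  · -- `V < 0`: `B = e^{-V}`, `c = -1`
    have hBgt : 1 < Real.exp (-V) := by
      rw [← Real.exp_zero]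
      exact Real.exp_lt_exp.mpr (by linarith)
    have hBa : IsAlgebraic ℚ (Real.exp (-V)) := by
      have : -V = ∑ i, ((-ε i : ℤ) : ℝ) * Real.log (β i / α i) := by
        rw [hV, ← Finset.sum_neg_distrib]
        refine Finset.sum_congr rfl fun i _ => ?_
        push_cast
        ring
      rw [this]
      exact isAlgebraic_exp_sum_mul_log (fun i => β i / α i) (fun i => -ε i)
        (fun i => div_pos ((hα i).trans_le (hαβ i)) (hα i)) (fun i => (hβa i).mul
          (IsAlgebraic.inv_iff.mpr (hαa i)))
    obtain ⟨rB, hdB, hiB⟩ := exists_logRep (a := 1) (b := Real.exp (-V)) one_pos isAlgebraic_one hBa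
    refine ⟨-1, Real.exp (-V), rB, hBgt, hBa, hdB, fun t _ => by simp [hiB], ?_⟩
    exact key (-1) _ rB hBgt.le hBa hdB (fun t _ => by simp [hiB]) (by
      rw [Real.log_exp]
      push_cast
      ring)
  · -- `V = 0`: `c = 0`, `B = 2`
    obtain ⟨rB, hdB, hiB⟩ := exists_logRep (a := 1) (b := 2) one_pos isAlgebraic_one
      (by simpa using isAlgebraic_algebraMap (R := ℚ) (A := ℝ) 2)
    refine ⟨0, 2, rB, by norm_num, by simpa using isAlgebraic_algebraMap (R := ℚ) (A := ℝ) 2, hdB,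
      fun t _ => by simp [hiB], ?_⟩
    exact key 0 2 rB (by norm_num) (by simpa using isAlgebraic_algebraMap (R := ℚ) (A := ℝ) 2) hdB
      (fun t _ => by simp [hiB]) (by rw [hzero]; push_cast; ring)
  · -- `V > 0`: `B = e^{V}`, `c = 1`
    have hBgt : 1 < Real.exp V := by
      rw [← Real.exp_zero]
      exact Real.exp_lt_exp.mpr hpos
    have hBa : IsAlgebraic ℚ (Real.exp V) := by
      rw [hV]
      exact isAlgebraic_exp_sum_mul_log (fun i => β i / α i) ε
        (fun i => div_pos ((hα i).trans_le (hαβ i)) (hα i)) (fun i => (hβa i).mul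
          (IsAlgebraic.inv_iff.mpr (hαa i)))
    obtain ⟨rB, hdB, hiB⟩ := exists_logRep (a := 1) (b := Real.exp V) one_pos isAlgebraic_one hBa
    refine ⟨1, Real.exp V, rB, hBgt, hBa, hdB, fun t _ => by simp [hiB], ?_⟩
    exact key 1 _ rB hBgt.le hBa hdB (fun t _ => by simp [hiB]) (by
      rw [Real.log_exp]
      push_cast
      ring)

end Summit.KontsevichZagierPeriods.KontsevichZagierPeriods.Cruxes.NeronTorsionSector.Translation
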